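import Literature.AnabelianGeometry.SemiGraphs.PSCVertexStabilizerProofs
import Literature.GroupTheory.CompactGroupIntersections
import HarnessLib

/-!
# [CombGC] Theorem 1.6 (iii), necessity: reduction to a LEVEL-WISE recognition of vertex stabilizers

Mochizuki, *Inter-universal Teichmüller theory I*, Remark 1.2.3 (iv), kurims manuscript p. 42 (the
replacement text of [CombGC] Remark 1.4.3, verticial part): "in order to characterize the unramified
verticial subgroups of `Π^unr_G`, it suffices — by considering stabilizers of vertices of underlying
semi-graphs of finite étale `Π^unr_G`-coverings of `G` — to give a functorial characterization of the
set of vertices of `G` [i.e., a characterization which may also be applied to finite étale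
`Π^unr_G`-coverings of `G`]"; and Remark 1.2.3 (vii), p. 43 (the replacement text of the final paragraph
of the proof of [CombGC] Theorem 1.6 (iii)): "necessity [verticially filtration-preserving ⇒
group-theoretically verticial] follows formally from the characterization of unramified verticial
subgroups given in Remark 1.4.3 …". [cite: Mochizuki2012, IUTchI Rmk 1.2.3(iv) p.42]
[cite: MochizukiCombGC2007, Thm 1.6(iii) p.14]

Over abc-iut-L3-t4's interface (`PSCFundamentalGroup.lean`, `PSCGraphicity.lean`) the vertices of the
`Π^unr_G`-covering `G_U` (open normal `U ⊇ Ker(Π_G ↠ Π^unr_G)`) over the vertex `v` are the double cosets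
`U γ Π_v`, with stabilizer `U · Π_v^γ = U ⊔ Π_v^γ` under the Galois group `Π_G/U`.  Row T16-L14 of the
cell's sub-DAG (abc-iut-w4-d052, `PSCVertexStabilizerProofs.lean`) proves that the unramified verticial
subgroups `Π_v^γ · Ker` are the intersections `⋂_U (U ⊔ Π_v^γ)` — the stabilizers of the COMPATIBLE
systems of vertices determined by ONE pair `(v, γ)`.  This proof-only file removes the coherence from
the hypothesis, which is what makes "a functorial characterization of the SET of vertices" usable:

* `isUnrVerticial_iff_levelwise` — for profinite `Π_G`, a subgroup `B` is unramified verticial if and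
  only if `B` is closed, contains `Ker(Π_G ↠ Π^unr_G)`, and AT EVERY LEVEL `U` the subgroup `B ⊔ U` is
  SOME vertex stabilizer `U ⊔ Π_v^γ` of `G_U` (no compatibility of the pairs `(v, γ)` chosen at the
  various levels is assumed: a coherent choice is produced by a compactness selection over the
  directed system of levels, `Literature.GroupTheory.CompactGroupIntersections`);
* `isUnrGroupTheoreticallyVerticial_iff_levelwise` — consequently, for ANY isomorphism
  `β : Π^unr_G ⥲ Π^unr_H` of profinite groups (Def. 1.4 (iv) for `β`; `β` need not be induced by an
  isomorphism `Π_G ⥲ Π_H`), `β` is group-theoretically verticial if and only if, at every level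
  `U ⊇ Ker`, the transport `unrTransport β` carries the set of vertex stabilizers `{U ⊔ Π_v^γ}` of
  `G_U` onto the set of vertex stabilizers of `H_{β(U)}` — i.e. iff `β` induces, functorially in the
  level, `Π_G/U`-equivariant bijections between the sets of vertices, read on their stabilizers.

With the second theorem, the necessity half of Theorem 1.6 (iii) (cell row T16-L16; abc-iut-L5's
typed fact `Rmk123.UnrVerticialNecessityReduction`) REDUCES to: "a verticially filtration-preserving
`β` induces such level-wise correspondences of vertex stabilizers" — the job of the level-wise
characterizations of [IUTchI] Rmk. 1.2.3 (iii), (iv) (rows T16-L13/L15, GAP G-w4d052-1), not touched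
here.  Also recorded: the elementary calculus of `unrTransport β` (monotone, `⊔`, closedness,
openness, normality; inverse transport along `β.symm`).

Proof-only (0 defs): plain profinite group theory over the interface; no statement of [CombGC] or
[IUTchI] is asserted; nothing here takes a side on [IUTchIII] Cor. 3.12.
-/

noncomputable section

namespace Literature.AnabelianGeometry.SemiGraphs

namespace PSCDatum

open scoped Pointwise

universe u

variable {P : Type u} [Group P] [TopologicalSpace P]

/-! ### 1. Two lattice identities for the level-wise stabilizers `B ⊔ U` -/

omit [TopologicalSpace P] in
/-- Conjugating by an element of the normal subgroup `U` does not change `U ⊔ X`: the stabilizer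
`U ⊔ Π_v^γ` of the vertex `U γ Π_v` of `G_U` depends only on the coset `U γ`. [folklore] -/
private theorem sup_conjAct_smul_eq_of_mem {U : Subgroup P} (hU : U.Normal) {u : P} (hu : u ∈ U)
    (X : Subgroup P) : U ⊔ ConjAct.toConjAct u • X = U ⊔ X := by
  have h1 : ConjAct.toConjAct u • (U ⊔ X) = U ⊔ X :=
    Subgroup.conjAct_pointwise_smul_eq_self (Subgroup.le_normalizer (Subgroup.mem_sup_left hu))
  rwa [Subgroup.smul_sup, hU.conjAct (ConjAct.toConjAct u)] at h1

omit [TopologicalSpace P] in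
/-- If `B ⊔ U' = U' ⊔ X` at a level `U'`, then `B ⊔ U = U ⊔ X` at every coarser level `U ⊇ U'` (the
image of a vertex stabilizer of `G_{U'}` is the stabilizer of the image vertex of `G_U`). [folklore] -/
private theorem sup_eq_sup_of_le {B U U' X : Subgroup P} (hUU' : U' ≤ U) (h : B ⊔ U' = U' ⊔ X) :
    B ⊔ U = U ⊔ X := by
  calc B ⊔ U = B ⊔ U' ⊔ U := by rw [sup_assoc, sup_eq_right.mpr hUU']
    _ = U' ⊔ X ⊔ U := by rw [h]
    _ = U ⊔ X := by rw [sup_right_comm, sup_eq_right.mpr hUU']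

/-! ### 2. Unramified verticial subgroups are recognised LEVEL-WISE ([IUTchI] Rmk. 1.2.3 (iv)) -/

section Levelwise

variable [IsTopologicalGroup P]

/-- A subset of a topological group which is saturated for left multiplication by an open subgroup
`U` (a union of cosets `U g`) is clopen. [folklore] -/
private theorem isClopen_of_forall_mul_mem_iff {U : Subgroup P} (hU : IsOpen (U : Set P)) {C : Set P}
    (h : ∀ u ∈ U, ∀ g : P, u * g ∈ C ↔ g ∈ C) : IsClopen C := by
  have hopen : ∀ D : Set P, (∀ u ∈ U, ∀ g : P, u * g ∈ D ↔ g ∈ D) → IsOpen D := by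
    intro D hD
    refine isOpen_iff_forall_mem_open.mpr fun g hg => ?_
    refine ⟨(fun u : P => u * g) '' (U : Set P), ?_, (isOpenMap_mul_right g) _ hU,
      ⟨1, U.one_mem, one_mul g⟩⟩
    rintro _ ⟨u, hu, rfl⟩
    exact (hD u hu g).mpr hg
  refine ⟨?_, hopen C h⟩
  rw [← isOpen_compl_iff]
  exact hopen Cᶜ fun u hu g => by simp only [Set.mem_compl_iff, h u hu g]

/-- The easy half, valid for every datum: an unramified verticial subgroup `B = Π_v^γ · Ker` contains
`Ker(Π_G ↠ Π^unr_G)`, and at every level `U ⊇ Ker` the subgroup `B ⊔ U` is the stabilizer `U ⊔ Π_v^γ`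
of the vertex `U γ Π_v` of `G_U`. [cite: Mochizuki2012, IUTchI Rmk 1.2.3(iv) p.42] -/
theorem levelwise_of_isUnrVerticial (G : PSCDatum P) {B : Subgroup P} (hB : G.IsUnrVerticial B) :
    G.unrKer ≤ B ∧ ∃ (v : G.graph.V) (γ : ConjAct P), ∀ U : Subgroup P, G.unrKer ≤ U →
      B ⊔ U = U ⊔ γ • G.vertGp v := by
  obtain ⟨A, ⟨v, γ, rfl⟩, rfl⟩ := hB
  refine ⟨le_sup_right, v, γ, fun U hKU => ?_⟩
  rw [sup_assoc, sup_eq_right.mpr hKU, sup_comm]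

variable [CompactSpace P] [TotallyDisconnectedSpace P]

/-- Over a profinite group an unramified verticial subgroup is closed (it is the intersection of the
open subgroups `U ⊔ Π_v^γ`, row T16-L14). [cite: Mochizuki2012, IUTchI Rmk 1.2.3(iv) p.42] -/
theorem isClosed_of_isUnrVerticial (G : PSCDatum P) {B : Subgroup P} (hB : G.IsUnrVerticial B) :
    IsClosed (B : Set P) := by
  haveI : T2Space P := inferInstance
  obtain ⟨A, ⟨v, γ, rfl⟩, rfl⟩ := hB
  rw [G.smul_vertGp_sup_unrKer_eq_iInf v γ, Subgroup.coe_iInf]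
  exact isClosed_iInter fun U =>
    Subgroup.isClosed_of_isOpen _ (Subgroup.isOpen_mono le_sup_left U.2.2.1)

/-- **[IUTchI] Remark 1.2.3 (iv), "it suffices — by considering stabilizers of vertices of underlying
semi-graphs of finite étale `Π^unr_G`-coverings of `G` — to give a functorial characterization of the
set of vertices"** (p. 42), in its strongest form over the interface: for profinite `Π_G`, a subgroup
`B ⊆ Π_G` is unramified verticial (`B = Π_v^γ · Ker(Π_G ↠ Π^unr_G)`) if and only if `B` is closed,
contains `Ker(Π_G ↠ Π^unr_G)`, and for EVERY open normal `U ⊇ Ker` the subgroup `B ⊔ U` is the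
stabilizer `U ⊔ Π_v^γ = U · Π_v^γ` of SOME vertex `U γ Π_v` of the covering `G_U` — with no compatibility
between the vertices so recognised at the various levels assumed.  (A compatible system is extracted by
compactness: the sets of admissible `γ` at the levels form a directed family of nonempty clopen subsets
of `Π_G`; then `B = ⋂_U (B ⊔ U) = ⋂_U (U ⊔ Π_v^γ) = Π_v^γ · Ker` by row T16-L14.)
[cite: Mochizuki2012, IUTchI Rmk 1.2.3(iv) p.42] -/
theorem isUnrVerticial_iff_levelwise (G : PSCDatum P) (B : Subgroup P) :
    G.IsUnrVerticial B ↔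
      IsClosed (B : Set P) ∧ G.unrKer ≤ B ∧
        ∀ U : Subgroup P, U.Normal → IsOpen (U : Set P) → G.unrKer ≤ U →
          ∃ (v : G.graph.V) (γ : ConjAct P), B ⊔ U = U ⊔ γ • G.vertGp v := by
  haveI : T2Space P := inferInstance
  constructor
  · intro hB
    obtain ⟨hKB, v, γ, hlev⟩ := G.levelwise_of_isUnrVerticial hB
    exact ⟨G.isClosed_of_isUnrVerticial hB, hKB, fun U _ _ hKU => ⟨v, γ, hlev U hKU⟩⟩
  · rintro ⟨hBc, hKB, hlev⟩
    -- the directed system of levels (open normal subgroups containing `Ker(Π_G ↠ Π^unr_G)`)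
    let 𝒰 := {U : Subgroup P // U.Normal ∧ IsOpen (U : Set P) ∧ G.unrKer ≤ U}
    -- the admissible conjugators at level `U` for the vertex `v`
    let C : G.graph.V → 𝒰 → Set P := fun v U =>
      {g : P | B ⊔ U.1 = U.1 ⊔ ConjAct.toConjAct g • G.vertGp v}
    have hanti : ∀ (v) (U U' : 𝒰), U'.1 ≤ U.1 → C v U' ⊆ C v U :=
      fun v U U' hle g hg => sup_eq_sup_of_le hle hg
    have hsat : ∀ (v) (U : 𝒰), ∀ u ∈ U.1, ∀ g : P, u * g ∈ C v U ↔ g ∈ C v U := by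
      intro v U u hu g
      simp only [C, Set.mem_setOf_eq, map_mul, mul_smul, sup_conjAct_smul_eq_of_mem U.2.1 hu]
    have hclosed : ∀ v U, IsClosed (C v U) := fun v U =>
      (isClopen_of_forall_mul_mem_iff U.2.2.1 (hsat v U)).1
    -- some vertex `v₀` is admissible at every level (the levels are closed under finite `⊓`)
    obtain ⟨v₀, hv₀⟩ : ∃ v, ∀ U : 𝒰, (C v U).Nonempty := by
      by_contra hcon
      simp only [not_exists, not_forall, Set.not_nonempty_iff_eq_empty] at hcon
      choose Uof hUof using hcon
      have hn : (⨅ v, (Uof v).1).Normal := Subgroup.normal_iInf_normal fun v => (Uof v).2.1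
      have ho : IsOpen ((⨅ v, (Uof v).1 : Subgroup P) : Set P) := by
        rw [Subgroup.coe_iInf]
        exact isOpen_iInter_of_finite fun v => (Uof v).2.2.1
      have hk : G.unrKer ≤ ⨅ v, (Uof v).1 := le_iInf fun v => (Uof v).2.2.2
      obtain ⟨v, γ, hvγ⟩ := hlev _ hn ho hk
      have hmem : ConjAct.ofConjAct γ ∈ C v ⟨⨅ v, (Uof v).1, hn, ho, hk⟩ := by
        simp only [C, Set.mem_setOf_eq, ConjAct.toConjAct_ofConjAct]
        exact hvγ
      have := hanti v (Uof v) ⟨⨅ v, (Uof v).1, hn, ho, hk⟩ (iInf_le _ v) hmem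
      rw [hUof v] at this
      exact this
    -- uniformisation: one conjugator admissible at every level
    haveI : Nonempty 𝒰 := ⟨⟨⊤, inferInstance, by simp, le_top⟩⟩
    have hdir : Directed (· ⊇ ·) (C v₀) := by
      intro U₁ U₂
      have hn : (U₁.1 ⊓ U₂.1).Normal :=
        @Subgroup.normal_inf_normal _ _ U₁.1 U₂.1 U₁.2.1 U₂.2.1
      have ho : IsOpen ((U₁.1 ⊓ U₂.1 : Subgroup P) : Set P) := by
        rw [Subgroup.coe_inf]
        exact U₁.2.2.1.inter U₂.2.2.1
      exact ⟨⟨U₁.1 ⊓ U₂.1, hn, ho, le_inf U₁.2.2.2 U₂.2.2.2⟩,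
        hanti v₀ U₁ _ inf_le_left, hanti v₀ U₂ _ inf_le_right⟩
    obtain ⟨g, hg⟩ :=
      Literature.GroupTheory.CompactGroupIntersections.exists_mem_forall_of_directed
        (C v₀) hdir hv₀ (hclosed v₀)
    -- conclusion: `B = ⋂_U (B ⊔ U) = ⋂_U (U ⊔ Π_{v₀}^g) = Π_{v₀}^g · Ker`
    have hlev' : ∀ U : 𝒰, B ⊔ U.1 = U.1 ⊔ ConjAct.toConjAct g • G.vertGp v₀ := fun U => hg U
    refine ⟨ConjAct.toConjAct g • G.vertGp v₀, ⟨v₀, ConjAct.toConjAct g, rfl⟩, le_antisymm ?_ ?_⟩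
    · rw [G.smul_vertGp_sup_unrKer_eq_iInf v₀ (ConjAct.toConjAct g)]
      exact le_iInf fun U => le_sup_left.trans (hlev' U).le
    · rw [G.smul_vertGp_sup_unrKer_eq_iInf v₀ (ConjAct.toConjAct g)]
      intro x hx
      refine mem_of_forall_mem_mul hBc hKB fun U hUo hUn hKU => ?_
      haveI := hUn
      rw [← Subgroup.normal_mul, sup_comm, hlev' ⟨U, hUn, hUo, hKU⟩]
      exact Subgroup.mem_iInf.mp hx ⟨U, hUn, hUo, hKU⟩

end Levelwise

/-! ### 3. The transport `unrTransport β` along `β : Π^unr_G ⥲ Π^unr_H` -/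

section Transport

variable [IsTopologicalGroup P]
variable {P' : Type u} [Group P'] [TopologicalSpace P'] [IsTopologicalGroup P']
variable (G : PSCDatum P) (H : PSCDatum P') (β : (P ⧸ G.unrKer) ≃ₜ* (P' ⧸ H.unrKer))

/-- Membership in the transport: `x ∈ unrTransport β S` iff `β` carries the image of some `s ∈ S` in
`Π^unr_G` to the image of `x` in `Π^unr_H`. [cite: MochizukiCombGC2007, Def 1.4(iii) p.10] -/
theorem mem_unrTransport_iff {S : Subgroup P} {x : P'} :
    x ∈ G.unrTransport H β S ↔
      ∃ s ∈ S, β (QuotientGroup.mk s) = (QuotientGroup.mk x : P' ⧸ H.unrKer) := by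
  simp only [unrTransport, Subgroup.mem_comap, Subgroup.mem_map, QuotientGroup.mk'_apply,
    MulEquiv.coe_toMonoidHom, exists_exists_and_eq_and]
  rfl

/-- As a subset, `unrTransport β S` is the preimage under `Π_H ↠ Π^unr_H` of the `β`-image of the image of
`S` in `Π^unr_G`. [cite: MochizukiCombGC2007, Def 1.4(iii) p.10] -/
theorem coe_unrTransport (S : Subgroup P) :
    (G.unrTransport H β S : Set P') =
      QuotientGroup.mk ⁻¹' (β '' (QuotientGroup.mk '' (S : Set P))) := by
  ext x
  simp only [SetLike.mem_coe, mem_unrTransport_iff, Set.mem_preimage, Set.mem_image,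
    exists_exists_and_eq_and]

/-- The transport contains `Ker(Π_H ↠ Π^unr_H)`. [cite: MochizukiCombGC2007, Def 1.4(iii) p.10] -/
theorem unrKer_le_unrTransport (S : Subgroup P) : H.unrKer ≤ G.unrTransport H β S := by
  intro x hx
  rw [mem_unrTransport_iff]
  refine ⟨1, S.one_mem, ?_⟩
  rw [QuotientGroup.mk_one, map_one, eq_comm, QuotientGroup.eq_one_iff]
  exact hx

/-- The transport is monotone. [cite: MochizukiCombGC2007, Def 1.4(iii) p.10] -/
theorem unrTransport_mono {S₁ S₂ : Subgroup P} (h : S₁ ≤ S₂) :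
    G.unrTransport H β S₁ ≤ G.unrTransport H β S₂ :=
  Subgroup.comap_mono (Subgroup.map_mono (Subgroup.map_mono h))

/-- The transport preserves `⊔`. [cite: MochizukiCombGC2007, Def 1.4(iii) p.10] -/
theorem unrTransport_sup (S₁ S₂ : Subgroup P) :
    G.unrTransport H β (S₁ ⊔ S₂) = G.unrTransport H β S₁ ⊔ G.unrTransport H β S₂ := by
  simp only [unrTransport, Subgroup.map_sup]
  exact (Subgroup.comap_sup_eq _ _ _ (QuotientGroup.mk'_surjective _)).symm

/-- Transport along `β` and back along `β.symm` is the identity on subgroups containing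
`Ker(Π_G ↠ Π^unr_G)`. [cite: MochizukiCombGC2007, Def 1.4(iii) p.10] -/
theorem unrTransport_symm_unrTransport {S : Subgroup P} (hS : G.unrKer ≤ S) :
    H.unrTransport G β.symm (G.unrTransport H β S) = S := by
  unfold unrTransport
  rw [Subgroup.map_comap_eq_self_of_surjective (QuotientGroup.mk'_surjective _), Subgroup.map_map]
  have hcomp : β.symm.toMulEquiv.toMonoidHom.comp β.toMulEquiv.toMonoidHom = MonoidHom.id _ :=
    MonoidHom.ext fun x => β.symm_apply_apply x
  rw [hcomp, Subgroup.map_id, Subgroup.comap_map_eq, QuotientGroup.ker_mk', sup_eq_left.mpr hS]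

/-- Transport along `β.symm` and then along `β` is the identity on subgroups containing
`Ker(Π_H ↠ Π^unr_H)`. [cite: MochizukiCombGC2007, Def 1.4(iii) p.10] -/
theorem unrTransport_unrTransport_symm {S' : Subgroup P'} (hS' : H.unrKer ≤ S') :
    G.unrTransport H β (H.unrTransport G β.symm S') = S' :=
  H.unrTransport_symm_unrTransport G β.symm hS'

/-- The transport of a normal subgroup is normal. [cite: MochizukiCombGC2007, Def 1.4(iii) p.10] -/
theorem normal_unrTransport {S : Subgroup P} (hS : S.Normal) : (G.unrTransport H β S).Normal := by
  unfold unrTransport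
  haveI := (hS.map _ (QuotientGroup.mk'_surjective G.unrKer)).map β.toMulEquiv.toMonoidHom
    β.toMulEquiv.surjective
  infer_instance

/-- The transport of an open subgroup is open (the projections are open and continuous, `β` is a
homeomorphism). [cite: MochizukiCombGC2007, Def 1.4(iii) p.10] -/
theorem isOpen_unrTransport {S : Subgroup P} (hS : IsOpen (S : Set P)) :
    IsOpen (G.unrTransport H β S : Set P') := by
  rw [coe_unrTransport]
  refine IsOpen.preimage QuotientGroup.continuous_mk ?_
  exact β.toHomeomorph.isOpenMap _ (QuotientGroup.isOpenMap_coe _ hS)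

/-- Over a compact `Π_G`, the transport of a closed subgroup is closed (`Π^unr_H` is Hausdorff since
`Ker(Π_H ↠ Π^unr_H)` is closed). [cite: MochizukiCombGC2007, Def 1.4(iii) p.10] -/
theorem isClosed_unrTransport [CompactSpace P] {S : Subgroup P} (hS : IsClosed (S : Set P)) :
    IsClosed (G.unrTransport H β S : Set P') := by
  haveI : IsClosed (H.unrKer : Set P') := Subgroup.isClosed_topologicalClosure _
  rw [coe_unrTransport]
  refine IsClosed.preimage QuotientGroup.continuous_mk ?_
  exact ((hS.isCompact.image QuotientGroup.continuous_mk).image (map_continuous β)).isClosed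

/-- The transport carries the levels of `G` (open normal subgroups containing `Ker(Π_G ↠ Π^unr_G)`) to
levels of `H`. [cite: MochizukiCombGC2007, Def 1.4(iii) p.10] -/
theorem level_unrTransport {U : Subgroup P} (hUn : U.Normal) (hUo : IsOpen (U : Set P)) :
    (G.unrTransport H β U).Normal ∧ IsOpen (G.unrTransport H β U : Set P') ∧
      H.unrKer ≤ G.unrTransport H β U :=
  ⟨G.normal_unrTransport H β hUn, G.isOpen_unrTransport H β hUo, G.unrKer_le_unrTransport H β U⟩

end Transport

/-! ### 4. Group-theoretic verticiality of `β` ⟺ level-wise correspondence of vertex stabilizers -/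

section Verticial

variable [IsTopologicalGroup P] [CompactSpace P] [TotallyDisconnectedSpace P]
variable {P' : Type u} [Group P'] [TopologicalSpace P'] [IsTopologicalGroup P'] [CompactSpace P']
  [TotallyDisconnectedSpace P']
variable (G : PSCDatum P) (H : PSCDatum P') (β : (P ⧸ G.unrKer) ≃ₜ* (P' ⧸ H.unrKer))

/-- **The reduction of [CombGC] Thm. 1.6 (iii), necessity, to a level-wise statement** ([IUTchI]
Rmk. 1.2.3 (iv) p. 42 / (vii) p. 43): let `β : Π^unr_G ⥲ Π^unr_H` be any isomorphism of profinite
groups (over the interface: of the quotients by `Ker(Π ↠ Π^unr)`).  If at every level `U ⊇ Ker` of `G`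
the transport along `β` carries the set of vertex stabilizers `{U ⊔ Π_v^γ}` of the covering `G_U`
ONTO the set of vertex stabilizers of the corresponding covering `H_{β(U)}` — i.e. `β` induces
`Π_G/U ≅ Π_H/β(U)`-equivariant bijections `Vert(G_U) ≅ Vert(H_{β(U)})`, read on stabilizers — then `β`
is group-theoretically verticial (Def. 1.4 (iv)): it carries the unramified verticial subgroups of
`Π^unr_G` onto those of `Π^unr_H`. [cite: Mochizuki2012, IUTchI Rmk 1.2.3(vii) p.43] -/
theorem isUnrGroupTheoreticallyVerticial_of_levelwise
    (hβ : ∀ U : Subgroup P, U.Normal → IsOpen (U : Set P) → G.unrKer ≤ U →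
      ∀ S : Subgroup P, U ≤ S →
        ((∃ (v : G.graph.V) (γ : ConjAct P), S = U ⊔ γ • G.vertGp v) ↔
          ∃ (w : H.graph.V) (δ : ConjAct P'),
            G.unrTransport H β S = G.unrTransport H β U ⊔ δ • H.vertGp w)) :
    G.IsUnrGroupTheoreticallyVerticial H β := by
  constructor
  · intro B hB
    obtain ⟨hBc, hKB, hlev⟩ := (G.isUnrVerticial_iff_levelwise B).mp hB
    refine (H.isUnrVerticial_iff_levelwise _).mpr
      ⟨G.isClosed_unrTransport H β hBc, G.unrKer_le_unrTransport H β B, fun U' hU'n hU'o hKU' => ?_⟩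
    -- pull the level `U'` of `H` back to the level `U` of `G`
    obtain ⟨hUn, hUo, hKU⟩ := H.level_unrTransport G β.symm hU'n hU'o
    set U := H.unrTransport G β.symm U' with hU
    have hUU' : G.unrTransport H β U = U' := G.unrTransport_unrTransport_symm H β hKU'
    obtain ⟨v, γ, hvγ⟩ := hlev U hUn hUo hKU
    obtain ⟨w, δ, hwδ⟩ :=
      (hβ U hUn hUo hKU (B ⊔ U) le_sup_right).mp ⟨v, γ, hvγ⟩
    refine ⟨w, δ, ?_⟩
    rw [← hUU', ← G.unrTransport_sup H β, hwδ]
  · intro B' hB'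
    obtain ⟨hB'c, hKB', hlev'⟩ := (H.isUnrVerticial_iff_levelwise B').mp hB'
    set B := H.unrTransport G β.symm B' with hB
    have hBB' : G.unrTransport H β B = B' := G.unrTransport_unrTransport_symm H β hKB'
    refine ⟨B, (G.isUnrVerticial_iff_levelwise B).mpr
      ⟨H.isClosed_unrTransport G β.symm hB'c, H.unrKer_le_unrTransport G β.symm B',
        fun U hUn hUo hKU => ?_⟩, hBB'⟩
    obtain ⟨hU'n, hU'o, hKU'⟩ := G.level_unrTransport H β hUn hUo
    obtain ⟨w, δ, hwδ⟩ := hlev' _ hU'n hU'o hKU'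
    refine (hβ U hUn hUo hKU (B ⊔ U) le_sup_right).mpr ⟨w, δ, ?_⟩
    rw [G.unrTransport_sup H β, hBB', hwδ]

omit [CompactSpace P] [TotallyDisconnectedSpace P] [CompactSpace P'] [TotallyDisconnectedSpace P'] in
/-- The converse: a group-theoretically verticial `β` induces, at every level, the correspondence of
vertex stabilizers (the image under the transport of `U ⊔ Π_v^γ = U ⊔ (Π_v^γ · Ker)` is
`β(U) ⊔ β(Π_v^γ · Ker)`). [cite: Mochizuki2012, IUTchI Rmk 1.2.3(vii) p.43] -/
theorem levelwise_of_isUnrGroupTheoreticallyVerticial (h : G.IsUnrGroupTheoreticallyVerticial H β)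
    {U : Subgroup P} (hKU : G.unrKer ≤ U) {S : Subgroup P} (hUS : U ≤ S) :
    (∃ (v : G.graph.V) (γ : ConjAct P), S = U ⊔ γ • G.vertGp v) ↔
      ∃ (w : H.graph.V) (δ : ConjAct P'),
        G.unrTransport H β S = G.unrTransport H β U ⊔ δ • H.vertGp w := by
  have hKU' : H.unrKer ≤ G.unrTransport H β U := G.unrKer_le_unrTransport H β U
  constructor
  · rintro ⟨v, γ, rfl⟩
    obtain ⟨A', ⟨w, δ, rfl⟩, hA'⟩ := h.1 _ ⟨γ • G.vertGp v, ⟨v, γ, rfl⟩, rfl⟩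
    refine ⟨w, δ, ?_⟩
    -- `U ⊔ Π_v^γ = U ⊔ (Π_v^γ ⊔ Ker)` since `Ker ≤ U`
    have hS : U ⊔ γ • G.vertGp v = U ⊔ (γ • G.vertGp v ⊔ G.unrKer) := by
      rw [← sup_assoc, sup_right_comm, sup_eq_left.mpr hKU]
    rw [hS, G.unrTransport_sup H β, hA', ← sup_assoc, sup_right_comm, sup_eq_left.mpr hKU']
  · rintro ⟨w, δ, hwδ⟩
    obtain ⟨B, ⟨A, ⟨v, γ, rfl⟩, rfl⟩, hB⟩ := h.2 _ ⟨δ • H.vertGp w, ⟨w, δ, rfl⟩, rfl⟩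
    refine ⟨v, γ, ?_⟩
    have hKS : G.unrKer ≤ S := hKU.trans hUS
    -- transport back along `β.symm`
    have h1 : S = H.unrTransport G β.symm (G.unrTransport H β U ⊔ δ • H.vertGp w) := by
      rw [← hwδ, G.unrTransport_symm_unrTransport H β hKS]
    have h2 : G.unrTransport H β U ⊔ δ • H.vertGp w =
        G.unrTransport H β U ⊔ (δ • H.vertGp w ⊔ H.unrKer) := by
      rw [← sup_assoc, sup_right_comm, sup_eq_left.mpr hKU']
    rw [h1, h2, ← hB, ← G.unrTransport_sup H β, G.unrTransport_symm_unrTransport H β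
      (hKU.trans le_sup_left), ← sup_assoc, sup_right_comm, sup_eq_left.mpr hKU]

/-- **[CombGC] Thm. 1.6 (iii) / [IUTchI] Rmk. 1.2.3 (iv), (vii): group-theoretic verticiality of
`β : Π^unr_G ⥲ Π^unr_H` is EQUIVALENT to the level-wise correspondence of vertex stabilizers** under the
transport along `β`, for profinite `Π_G`, `Π_H` — the precise sense in which "it suffices … to give a
functorial characterization of the set of vertices" (p. 42).  The necessity half of Thm. 1.6 (iii) is
thereby the statement that a verticially filtration-preserving `β` induces these correspondences.
[cite: Mochizuki2012, IUTchI Rmk 1.2.3(iv) p.42] -/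
theorem isUnrGroupTheoreticallyVerticial_iff_levelwise :
    G.IsUnrGroupTheoreticallyVerticial H β ↔
      ∀ U : Subgroup P, U.Normal → IsOpen (U : Set P) → G.unrKer ≤ U →
        ∀ S : Subgroup P, U ≤ S →
          ((∃ (v : G.graph.V) (γ : ConjAct P), S = U ⊔ γ • G.vertGp v) ↔
            ∃ (w : H.graph.V) (δ : ConjAct P'),
              G.unrTransport H β S = G.unrTransport H β U ⊔ δ • H.vertGp w) :=
  ⟨fun h _ _ _ hKU _ hUS => G.levelwise_of_isUnrGroupTheoreticallyVerticial H β h hKU hUS,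
    G.isUnrGroupTheoreticallyVerticial_of_levelwise H β⟩

end Verticial

end PSCDatum

end Literature.AnabelianGeometry.SemiGraphs

end
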